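import Summits.AtomisticToContinuum.Crystallization.Theorems.PricedLinkCensusStackingHingeAllPointsOfRoot
import Literature.MathematicalPhysics.StatisticalMechanics.BarlowStacking

/-!
# `StackingHinge` (stmt-AtomisticToContinuum-14993), line `Sketch`: stub `stub_allPointsExact`

EVERYTHING SHOWS AT THE ROOT for the exact-window predicate.  For a point-stationary hard-core
probability law `P` on rooted configurations `μ = count|S`, `0 ∈ S` (Mecke / mass-transport
form), if `P`-a.s. the ROOT has an exact radius-`3` window onto a rotated copy
`A '' hcpStacking a h` of the relaxed hcp net, then `P`-a.s. EVERY point `x` of the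
configuration has one, stated for the translate `(· − x) '' S`.

Proof.  Hard-core configurations are locally finite
(`count_restrict_floorNorm_preimage_lt_top`), so the Aldous–Lyons lemma in Mecke form
(`ae_forall_map_sub_of_ae`, no measurability of the event needed) transports the a.s. root
property to the configuration re-rooted at every one of its points, `θ_x (count|S)`,
`x ∈ S` (`count_restrict_singleton_ne_zero_iff`).  The re-rooted configuration is
`count|((· − x) '' S)` (`map_sub_count_restrict`) and counting measures determine their sets
(`eq_of_count_restrict_eq`); since the conclusion is stated on the translate itself, no
covariance lemma is needed.  All `[folklore]`.
-/

noncomputable section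

namespace Summit.AtomisticToContinuum.Crystallization.Theorems.PricedHcpWindowsAllPointsExact

open MeasureTheory Set Literature.Probability.Process
open Summit.AtomisticToContinuum.Crystallization.Theorems.PalmUnimodularRigidity
  (ae_forall_map_sub_of_ae count_restrict_floorNorm_preimage_lt_top)
open Summit.AtomisticToContinuum.Crystallization.Theorems.PricedHcpWindowsAllPointsOfRoot
  (eq_of_count_restrict_eq)

/-! ## The stub -/

/-- **stub_allPointsExact** (EVERYTHING SHOWS AT THE ROOT for exact hcp windows).  For a
point-stationary hard-core probability law `P` (Mecke / mass-transport form), if a.s. the root has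
an exact radius-`3` window onto a rotated relaxed hcp net `A '' hcpStacking a h`, then a.s. EVERY
point `x` of the configuration `S` has one for the translate `(· − x) '' S`:
`ae_forall_map_sub_of_ae` (Aldous–Lyons Lemma 2.3 in Mecke form; local finiteness from the hard
core by `count_restrict_floorNorm_preimage_lt_top`), the re-rooting identity
`map_sub_count_restrict` (`θ_x count|S = count|((· − x) '' S)`) and injectivity of `S ↦ count|S`
(`eq_of_count_restrict_eq`). [folklore] -/
theorem stub_allPointsExact : ∀ a h : ℝ, ∀ δ : ℝ, 0 < δ → ∀ P : MeasureTheory.Measure (MeasureTheory.Measure (EuclideanSpace ℝ (Fin 3))), MeasureTheory.IsProbabilityMeasure P → (∀ᵐ μ ∂P, (∃ S : Set (EuclideanSpace ℝ (Fin 3)), (0 : EuclideanSpace ℝ (Fin 3)) ∈ S ∧ (∀ x ∈ S, ∀ y ∈ S, x ≠ y → δ ≤ dist x y) ∧ μ = (MeasureTheory.Measure.count : MeasureTheory.Measure (EuclideanSpace ℝ (Fin 3))).restrict S)) → (∀ g : MeasureTheory.Measure (EuclideanSpace ℝ (Fin 3)) → EuclideanSpace ℝ (Fin 3) → ENNReal,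 Measurable (Function.uncurry g) → ∫⁻ μ, ∫⁻ y, g μ y ∂μ ∂P = ∫⁻ μ, ∫⁻ y, g (MeasureTheory.Measure.map (fun z => z - y) μ) (-y) ∂μ ∂P) → (∀ᵐ μ ∂P, ∃ S : Set (EuclideanSpace ℝ (Fin 3)), μ = (MeasureTheory.Measure.count : MeasureTheory.Measure (EuclideanSpace ℝ (Fin 3))).restrict S ∧ (0 : EuclideanSpace ℝ (Fin 3)) ∈ S ∧ ∃ A : EuclideanSpace ℝ (Fin 3) ≃ₗᵢ[ℝ] EuclideanSpace ℝ (Fin 3), ((∀ y ∈ S, ‖y‖ ≤ 3 → ∃ z ∈ Literature.MathematicalPhysics.StatisticalMechanics.hcpStacking a h, y = A z) ∧ (∀ z ∈ Literature.MathematicalPhysics.StatisticalMechanics.hcpStacking a h, ‖z‖ ≤ 3 → A z ∈ S))) → (∀ᵐ μ ∂P, ∃ S : Set (EuclideanSpace ℝ (Fin 3)), μ = (MeasureTheory.Measure.count : MeasureTheory.Measure (EuclideanSpace ℝ (Fin 3))).restrict S ∧ ∀ x ∈ S, ∃ A : EuclideanSpace ℝ (Fin 3) ≃ₗᵢ[ℝ]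 EuclideanSpace ℝ (Fin 3), ((∀ y ∈ ((fun p : EuclideanSpace ℝ (Fin 3) => p - x) '' S), ‖y‖ ≤ 3 → ∃ z ∈ Literature.MathematicalPhysics.StatisticalMechanics.hcpStacking a h, y = A z) ∧ (∀ z ∈ Literature.MathematicalPhysics.StatisticalMechanics.hcpStacking a h, ‖z‖ ≤ 3 → A z ∈ ((fun p : EuclideanSpace ℝ (Fin 3) => p - x) '' S)))) := by
  intro a h δ hδ P _hP hcore hstat hroot
  -- hard-core configurations are locally finite
  have hlf : ∀ᵐ μ ∂P, ∀ n : ℕ,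
      μ ((fun z : EuclideanSpace ℝ (Fin 3) => ⌊‖z‖⌋₊) ⁻¹' {n}) < ⊤ := by
    filter_upwards [hcore] with μ hμ n
    obtain ⟨S, -, hsep, rfl⟩ := hμ
    exact count_restrict_floorNorm_preimage_lt_top hδ hsep n
  -- everything shows at the root: the re-rooted configuration has an exact root window, a.s.
  have hall := ae_forall_map_sub_of_ae hstat hlf hroot
  filter_upwards [hcore, hall] with μ hc ha
  obtain ⟨S, -, -, rfl⟩ := hc
  refine ⟨S, rfl, fun x hx => ?_⟩
  obtain ⟨S', hS', -, hwin⟩ := ha x ((count_restrict_singleton_ne_zero_iff S x).2 hx)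
  -- the re-rooted configuration is the counting measure of the translated set
  rw [map_sub_count_restrict] at hS'
  obtain rfl := eq_of_count_restrict_eq hS'
  exact hwin

end Summit.AtomisticToContinuum.Crystallization.Theorems.PricedHcpWindowsAllPointsExact
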